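import Summits.MatrixMultiplication.OmegaCensus.DominoZ19StructSixRows1
import HarnessLib

/-!
# Completeness rows 3–6 for the structural part-`6` route, `p = 19` (rows file 2 of 5)

ω-census `pub-omega`, family (b3), seat pub-omega-group gen 25.  Framing: lottery ticket; floor = certified bounds/negative
ranges.  VALUE: per-prime kernel data of the structural part-`6` route WITHOUT the pigeonhole (`DominoZpZpStructSixWide*.lean`)
for `p = 19` — target: the OPEN census cell `(1,6,20)@361` (`A = ℤ₁₉²`) and every larger order with such a quotient; NOT progress on ω.

-/

namespace Summit.MatrixMultiplication.OmegaCensus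

open ZpZpDomino

namespace ZpZpDomino

set_option maxRecDepth 100000 in
set_option maxHeartbeats 4000000 in
/-- Row `b = 3` of the completeness check (`19³` lookups). [folklore] -/
theorem checkSixRow_19_3 : checkSixRow 19 etZ19s6 tabTreeZ19s6 3 = true := by decide +kernel

set_option maxRecDepth 100000 in
set_option maxHeartbeats 4000000 in
/-- Row `b = 4` of the completeness check (`19³` lookups). [folklore] -/
theorem checkSixRow_19_4 : checkSixRow 19 etZ19s6 tabTreeZ19s6 4 = true := by decide +kernel

set_option maxRecDepth 100000 in
set_option maxHeartbeats 4000000 in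
/-- Row `b = 5` of the completeness check (`19³` lookups). [folklore] -/
theorem checkSixRow_19_5 : checkSixRow 19 etZ19s6 tabTreeZ19s6 5 = true := by decide +kernel

set_option maxRecDepth 100000 in
set_option maxHeartbeats 4000000 in
/-- Row `b = 6` of the completeness check (`19³` lookups). [folklore] -/
theorem checkSixRow_19_6 : checkSixRow 19 etZ19s6 tabTreeZ19s6 6 = true := by decide +kernel

end ZpZpDomino

end Summit.MatrixMultiplication.OmegaCensus
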